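import Literature.Computability.QuantumComplexity.QueryComplexity
import HarnessLib

/-!
# Barrier catalogue `QuantumAdvantage`: no superpolynomial black-box speedup for total functions (Beals–Buhrman–Cleve–Mosca–de Wolf; Aaronson–Ben-David–Kothari–Rao–Tal) — "the need for structure"

D-0021 barrier entry for the summit `QuantumAdvantage`
(`Summits/QuantumAdvantage/QuantumAdvantage/Statement.lean`:
`QuantumAdvantage := ∃ L, L ∈ BQP ∧ L ∉ BPP`), bearing on black-box (query) routes to quantum
speedups and on the oracle evidence `BQP^O ⊄ BPP^O`.

**The printed results** (held arXiv copies).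

* R. Beals, H. Buhrman, R. Cleve, M. Mosca, R. de Wolf, *Quantum lower bounds by polynomials*,
  J. ACM 48 (2001) 778–797 (FOCS 1998; arXiv:quant-ph/9802049) [BealsEtAl2001]. §1: "In the
  black-box model, the quantum speed-up for any total function cannot be more than by a
  sixth-root." **Theorem 5.4**: "If `f` is a Boolean function, then `D(f) ≤ 4096 Q₂(f)⁶`."
  Mechanism: Lemma 4.2 (the acceptance probability of a `T`-query network is a multilinear
  polynomial of degree `≤ 2T`), Thm. 4.13 (`Q₂(f) ≥ √(bs(f)/16)`), Lemma 5.3 and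
  `D(f) ≤ bs(f)³` (§5).
* S. Aaronson, S. Ben-David, R. Kothari, S. Rao, A. Tal, *Degree vs. approximate degree and
  quantum implications of Huang's sensitivity theorem*, STOC 2021 (arXiv:2010.12629)
  [AaronsonBenDavidKothariRaoTal2021]. **Theorem 1**: "For all Boolean functions
  `f : {0,1}ⁿ → {0,1}`, we have `D(f) = O(Q(f)⁴)`", matching the known separation up to log
  factors (Ambainis–Balodis–Belovs–Lee–Santha–Smotrovs 2017), §1 p. 2. Vendored in the tree as
  `Literature.Computability.QuantumComplexity.detQueryComplexity_le_pow_four` (quantum-advantage.S12).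
* S. Aaronson, A. Ambainis, *The need for structure in quantum speedups*, Theory Comput. 10
  (2014) (arXiv:0911.0996) [AaronsonAmbainis2014]. §1: "Quantum computers can offer
  superpolynomial speedups over classical computers, but only for certain 'structured'
  problems"; "For other 'unstructured' problems—such as computing the Parity or Majority of an
  `N`-bit string—quantum computers offer no asymptotic speedup at all over classical computers
  (see Beals et al.)"; Thm. 27: `R(f) = O(Q(f)²)` for every partial symmetric Boolean function.

**What this file adds.** The technique class as an explicit definition (`TotalSpeedupBeyond d`:
total Boolean functions exhibit black-box quantum speedups beyond the `d`-th power, by every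
constant factor), Beals et al.'s Theorem 5.4 typed WITH its constant (`bealsEtAl2001_thm54`,
which implies the tree's `∃ C` form `detQueryComplexity_le_pow_six`), the barrier decl
`TotalFunctionSpeedupLimit` with the D-0021 block, and the proved no-go readings: no speedup
beyond the 6th power (`not_totalSpeedupBeyond_six`), beyond the 4th power granted the ABKRT fact
(`not_totalSpeedupBeyond_four`), and the randomized forms `R(f) ≤ 4096 Q₂(f)⁶`
(`randQueryComplexity_le_of_thm54`, through the tree theorem `randQueryComplexity_le_det`).

**Where the barrier stops (barrier audit 2026-08-16, D-0021).** The printed theorems are about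
Boolean-valued total FUNCTIONS — decision tasks with exactly one correct answer on every input —
in the worst-case, bounded-error/exact query-count measures. "No promise on the input" does NOT
by itself force a polynomial quantum/classical relation for other kinds of task on the same
unstructured inputs: total SEARCH problems (relations), SAMPLING problems, average-case measures
and nondeterministic modes all carry unbounded black-box quantum advantages in print (see the
`evasions_known:` and `scope_caveats:` lines of `TotalFunctionSpeedupLimit`). The last section of
this file types the relational query measures over the tree's models (`randRelQueryComplexity`,
`quantumRelQueryComplexity`, verifier-defined search problems `relOfVerifier`), the relational
technique class `TotalSearchSpeedupBeyond d`, and the printed evasion as ONE named fact,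
`yamakawaZhandry2022_totalSearch` (Yamakawa–Zhandry's worst-case-complete proof of quantumness
read in the query model: `TotalSearchSpeedupBeyond d` for every `d`), with its no-polynomial-
relation reading `yamakawaZhandry2022_totalSearch.not_polynomially_related` and the dichotomy
`TotalFunctionSpeedupLimit.function_search_dichotomy`.

## Design notes

* Measures are the tree's: `D(f) = Literature.Computability.Complexity.detQueryComplexity f`,
  `R(f) = Literature.Computability.Complexity.randQueryComplexity (1/3) f`,
  `Q₂(f) = Literature.Computability.Cryptography.quantumQueryComplexity (1/3) f` (Beals et al.'s
  bounded-error `Q₂`, error `1/3`; model `QQueryAlg` of `QuantumQuery.lean`).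
* Inequalities are stated over `ℝ` (casts of natural numbers), as the tree's S12 facts are.
* Relational measures (last section): a deterministic query algorithm with outputs in an arbitrary
  type `O` is a querying strategy `T : DecisionTree N` (leaf labels ignored) with an output rule
  `out : List Bool → O` applied to the transcript of answers `answerPath x T`; randomized = `PMF`
  over such pairs (as `randQueryComplexity`); quantum = `QQueryAlg N` with the output read off the
  final computational-basis measurement by a fixed map `out` (the BBCMW output convention, here
  with non-Boolean range). Both are `sInf`s over `ℕ` with the same documented junk value
  `sInf ∅ = 0` as the tree's measures.

## Sources

* [BealsEtAl2001] arXiv:quant-ph/9802049 (read via `lit read arxiv:quant-ph/9802049`): §1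
  (p. 4), §3 (`Q₂ ≤ Q₀ ≤ Q_E ≤ D ≤ N`, p. 6), Lemma 4.2, Thm. 4.8, Thm. 4.13 (pp. 7–9), §5
  (Lemma 5.3, `D(f) ≤ bs(f)³`, Thm. 5.4, Cor. 5.5, p. 11; symmetric functions: at most quadratic
  gap, p. 11).
* [AaronsonBenDavidKothariRaoTal2021] arXiv:2010.12629 (read via `lit read arxiv:2010.12629`):
  §1 p. 2, Thm. 1, Thm. 2, Thm. 3 (p. 3), Thm. 4 (p. 4).
* [AaronsonAmbainis2014] arXiv:0911.0996v3 (read via `lit read arxiv:0911.0996`): §1 (p. 3),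
  Problem 1, Thm. 5 (`R = O(Q⁹ polylog Q)` for permutation-invariant partial `f : [M]^N → {0,1}`;
  7th power in the journal version), §4 (open problems), Thm. 27 (p. 18); tree file
  `Literature/Computability/QuantumComplexity/AaronsonAmbainis.lean` (`AAConjecture`,
  `AaronsonAmbainis2014_thm7`).
* [YamakawaZhandry2022FOCS] arXiv:2204.02063 (read via `lit read arxiv:2204.02063`): Cor. 1.3,
  §1.3 ("Extension to worst-case completeness"), Def. 6.1, §6.1 (construction), Lemma 4.2
  (parameters `|Σ| = 2^{λ^{Θ(1)}}`, `n = Θ(λ)`), Lemma 6.10, Lemma 6.11, Lemma 6.12; tree fact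
  `Literature.Computability.QuantumComplexity.yamakawa_zhandry` (quantum-advantage.S24, the
  random-oracle machine form of Cor. 1.3, `OracleSeparations.lean`, not imported here).
* [Aaronson2022Structure] arXiv:2209.06930 (read via `lit read arxiv:2209.06930`): §4 and §7
  (powers 6 → 4, tight; `R` vs `Q` exponent between 3 and 4; Chailloux, Ben-David et al.;
  "they evaded our conjecture by looking not at decision problems, but at NP search problems").
* [AaronsonChen2017] arXiv:1612.05903 §6 (Lemma 6.3, Thm. 6.4, Thm. 6.7, Thm. 6.8).
* [AmbainisDeWolf2001] arXiv:quant-ph/9904079, Thm. 4.1. [DeWolf2003] arXiv:cs/0001014, Thm. 2.4.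
  [Chailloux2019] arXiv:1810.01790, Thm. 2. [BenDavidEtAl2020] arXiv:2006.12760, Thms. 2–4.
* Tree facts used for the evasions: `simon_upper`, `simon_lower` (quantum-advantage.S10),
  `grover_bbbv` (S11), `raz_tal_forrelation` (S15) in `QueryComplexity.lean`.
-/

noncomputable section

namespace Literature.Barriers.QuantumAdvantage

open Literature.Computability.Complexity Literature.Computability.Cryptography Literature.Computability.QuantumComplexity

/-! ### The technique class -/

/-- **Technique class: black-box quantum speedups on total functions beyond the `d`-th power.**
`TotalSpeedupBeyond d` says that for every constant `C` some total Boolean function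
`f : {0,1}ᴺ → {0,1}` has deterministic query complexity exceeding `C · Q₂(f)^d` — i.e. the
query-model quantum speedup on total ("unstructured") functions is not bounded by a degree-`d`
polynomial. A superpolynomial (a fortiori exponential) black-box speedup on total functions
would give `TotalSpeedupBeyond d` for every `d`. [cite: BealsEtAl2001, §1 (the quantum speed-up for any total function cannot be more than by a sixth-root) and §5] [cite: AaronsonAmbainis2014, §1 (Problem 1)] -/
def TotalSpeedupBeyond (d : ℕ) : Prop :=
  ∀ C : ℝ, ∃ (N : ℕ) (f : (Fin N → Bool) → Bool),
    C * (quantumQueryComplexity (1 / 3) f : ℝ) ^ d < (detQueryComplexity f : ℝ)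

/-- Unfolding lemma. [folklore] -/
theorem totalSpeedupBeyond_iff (d : ℕ) :
    TotalSpeedupBeyond d ↔ ∀ C : ℝ, ∃ (N : ℕ) (f : (Fin N → Bool) → Bool),
      C * (quantumQueryComplexity (1 / 3) f : ℝ) ^ d < (detQueryComplexity f : ℝ) :=
  Iff.rfl

/-- A polynomial bound of degree `d` with SOME constant refutes speedups beyond `d`. [folklore] -/
theorem not_totalSpeedupBeyond_of_bound {d : ℕ} {C : ℝ}
    (h : ∀ (N : ℕ) (f : (Fin N → Bool) → Bool),
      (detQueryComplexity f : ℝ) ≤ C * (quantumQueryComplexity (1 / 3) f : ℝ) ^ d) :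
    ¬ TotalSpeedupBeyond d := by
  intro hs
  obtain ⟨N, f, hf⟩ := hs C
  exact absurd (h N f) (not_le.mpr hf)

/-! ### Beals–Buhrman–Cleve–Mosca–de Wolf, Theorem 5.4 -/

/-- **Beals–Buhrman–Cleve–Mosca–de Wolf 2001, Theorem 5.4**: "If `f` is a Boolean function,
then `D(f) ≤ 4096 Q₂(f)⁶`" — for every `N` and every total `f : {0,1}ᴺ → {0,1}`, with `D` the
deterministic decision-tree complexity and `Q₂` the bounded-error (error `1/3`) quantum query
complexity. [cite: BealsEtAl2001, Thm 5.4] -/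
def bealsEtAl2001_thm54 : Prop :=
  ∀ (N : ℕ) (f : (Fin N → Bool) → Bool),
    (detQueryComplexity f : ℝ) ≤ 4096 * (quantumQueryComplexity (1 / 3) f : ℝ) ^ 6

/-- Theorem 5.4 implies the tree's `∃ C` form quantum-advantage.S12
(`detQueryComplexity_le_pow_six`). [cite: BealsEtAl2001, Thm 5.4] -/
theorem bealsEtAl2001_thm54.detQueryComplexity_le_pow_six (h : bealsEtAl2001_thm54) :
    detQueryComplexity_le_pow_six :=
  ⟨4096, h⟩

/-! ### The barrier -/

/-- **No superpolynomial black-box quantum speedup for total functions** (the catalogue decl;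
definitionally Beals et al.'s Theorem 5.4, `bealsEtAl2001_thm54`).

BARRIER
technique_class: black-box, query-complexity, oracle and polynomial-method arguments about TOTAL Boolean FUNCTIONS — decision tasks `f : {0,1}^N → {0,1}` with exactly one correct answer on every input and no promise ("unstructured" DECISION problems: OR / Grover search as a decision problem, Parity, Majority, any total `f`); worst-case, bounded-error (`ε = 1/3`) or exact query COUNT. (Narrowed by the barrier audit of 2026-08-16: "unstructured problem" here means a total FUNCTION; total search problems, sampling problems and average-case measures are not in the class — see evasions 2–5.)
blocks: superpolynomial — indeed any better-than-sixth-power, and by ABKRT better-than-fourth-power — quantum speedups in the worst-case query complexity of TOTAL Boolean FUNCTIONS: `D(f) ≤ 4096 Q₂(f)⁶` (`bealsEtAl2001_thm54`, typed; `not_totalSpeedupBeyond_six`, `randQueryComplexity_le_of_thm54` proved) [cite: BealsEtAl2001, Thm 5.4 and §1], `D(f) = O(Q(f)⁴)` (tree fact `detQueryComplexity_le_pow_four`; `not_totalSpeedupBeyond_four` proved) [cite: AaronsonBenDavidKothariRaoTal2021, Thm 1]; hence a DECISION problem without a promise gives at most a polynomial (quartic; quadratic for symmetric `f`, e.g. OR)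 quantum/classical query gap [cite: AaronsonAmbainis2014, §1 (pp. 3–4)] and cannot by itself be the query-complexity source of an exponential oracle separation of decision classes `BQP^O ⊄ BPP^O` or of a superpolynomial speedup transferred to the (decision) summit; more is blocked than totality: for PARTIAL functions that are symmetric under permuting the input positions the gap is polynomial too — `R(f) = O(Q(f)²)` for Boolean inputs [cite: AaronsonAmbainis2014, Thm 27], `R(f) ≤ O(Q(f)³)` over any input alphabet [cite: Chailloux2019, Thm 2], `R ≤ Q^{O(1)}` for partial functions invariant under permuting inputs and alphabet (collision / element-distinctness type) [cite: AaronsonAmbainis2014, Thm 5], and `R(f) = O(Q(f)⁶)` for partial functions of an adjacency MATRIX invariant under relabelling vertices (graph and hypergraph symmetries) [cite: BenDavidEtAl2020, Thm 2 and Thm 3].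
because: the acceptance probability of a `T`-query quantum algorithm is a real multilinear polynomial of degree `≤ 2T` in the input bits, so `Q₂(f) ≥ deg̃(f)/2` and `Q₂(f) ≥ √(bs(f)/16)` [cite: BealsEtAl2001, Lemma 4.2, Thm 4.8 and Thm 4.13], while for TOTAL FUNCTIONS the classical measures are polynomially related to block sensitivity, `D(f) ≤ C⁽¹⁾(f) bs(f) ≤ bs(f)³`, giving `D(f) ≤ 4096 Q₂(f)⁶` [cite: BealsEtAl2001, §5 (Lemma 5.3, Thm 5.4)]; the quartic bound combines `deg(f) = O(deg̃(f)²)` (from Huang's sensitivity theorem via spectral sensitivity `λ(f) ≤ deg̃(f)·O(1)`) with `D(f) ≤ deg(f)²·…` [cite: AaronsonBenDavidKothariRaoTal2021, Thm 1, Thm 2 and Thm 3 (p. 3)]. Both classical steps (certificates, block sensitivity, `D ≤ C⁽¹⁾·bs`) use that `f` assigns ONE value to EVERY input: off a promise there is nothing to certify, and for a relation there is no unique value whose certificates could be intersected — which is exactly where the evasions below live.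
evasions_known: (1) STRUCTURE, i.e. promise problems / partial functions: Simon's problem has `Q₂ = O(n²)` but `R = Ω(2^{n/2})` Boolean queries (tree facts `simon_upper`, `simon_lower`) [cite: Simon1997, §3], period finding, hidden subgroups and quadratic-residue sequences are where all superpolynomial DECISION speedups live [cite: AaronsonAmbainis2014, §1 (p. 3)], Forrelation separates one quantum query from `AC⁰`/`PH`-type classical power (tree fact `raz_tal_forrelation`) [cite: RazTalJACM2022, Thm. 1.1], and in the adjacency-LIST model even graph-symmetric property testing has an exponential speedup [cite: BenDavidEtAl2020, Thm 4]; (2) TOTAL SEARCH PROBLEMS (relations) on unstructured inputs: relative to a RANDOM oracle there are NP search problems solvable by BQP machines and not by BPP machines (tree fact `yamakawa_zhandry`) [cite: YamakawaZhandry2022FOCS, Cor. 1.3], and the worst-case-complete variant of the Yamakawa–Zhandry proof of quantumness is a search problem over ARBITRARY oracle tables — no promise — whose solutions are checked with `poly(λ)` classical queries, which a `poly(λ)`-query quantum algorithm solves on EVERY oracle [cite: YamakawaZhandry2022FOCS, Lemma 6.11] while classical algorithms making `2^{λ^c}` queries succeed with probability `2^{-Ω(λ)}` [cite: YamakawaZhandry2022FOCS,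 Lemma 6.12 (with Def. 6.1 and Lemma 6.10)] — typed below as the named fact `yamakawaZhandry2022_totalSearch` (`TotalSearchSpeedupBeyond d` for every `d`); "they evaded [the need-for-structure conjecture] by looking not at decision problems, but at NP search problems. For those, it turns out that you can get exponential quantum speedups on random oracles" [cite: Aaronson2022Structure, §7 (with §4)]; (3) SAMPLING problems on unstructured inputs: Fourier Sampling of an arbitrary `f : {0,1}ⁿ → {±1}` is solved exactly by ONE quantum query but needs `Ω(N)` randomized queries to constant accuracy, "1 versus linear" [cite: AaronsonChen2017, Lemma 6.3 and Thm 6.8]; (4) AVERAGE-CASE (distributional) query complexity of a TOTAL function: for Simon's function made total, `Q^{unif}(f) ≤ 22n+1` while `R^{unif}(f) = Ω(2^{n/2})` under the uniform distribution, and super-exponential gaps under other distributions [cite: AmbainisDeWolf2001, Thm 4.1 (and §3, §5)]; (5) other MODES of computation on total functions: nondeterministic query complexity has the unbounded gap `NQ(f) = 1` versus `N(f) = n` [cite: DeWolf2003, Thm 2.4]; (6) `BQP`-complete problems (quantum simulation, Jones polynomial, linear systems) are explicitly outside the "need for structure" dictum [cite: AaronsonAmbainis2014, §1 (footnote, p.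 3)]; (7) within the class the exponent is settled for `D` but not for `R`: the quartic relation is tight up to logarithmic factors (Ambainis–Balodis–Belovs–Lee–Santha–Smotrovs: a total `f` with `D(f) = Ω̃(Q(f)⁴)`, so `TotalSpeedupBeyond d` HOLDS for `d < 4`) [cite: AaronsonBenDavidKothariRaoTal2021, §1 (p. 2)], while the largest possible `R`-versus-`Q` exponent for total functions is only known to lie between `3` and `4` [cite: Aaronson2022Structure, §7].
scope_caveats: query (black-box) COUNT only — nothing is said about time complexity, white-box problems or the summit's Turing-machine classes directly (a query-efficient classical simulation need not be time-efficient); TOTAL Boolean-valued FUNCTIONS (Beals et al., ABKRT) and symmetric PARTIAL functions (Aaronson–Ambainis Thm 27 / Chailloux / Ben-David et al., not typed here) only — general partial functions, total RELATIONS (search problems, even with efficiently checkable solutions), SAMPLING problems, AVERAGE-CASE measures and NONDETERMINISTIC / interactive settings are outside the theorems and do exhibit unbounded gaps on unstructured inputs (evasions 1–5), so this entry must not be invoked against a route whose black-box engine is a total search or sampling task (for those the relevant entries are `RandomOracleMethod` — the Aaronson–Ambainis conjecture, decision problems on MOST oracles — and the search/sampling-to-decision transfer itself); worst-case, bounded-error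 `ε = 1/3` (any constant by amplification) and exact measures; the constant `4096` is printed, ABKRT's `O(·)` constant is not; whether quantum query algorithms on MOST inputs of a random oracle are classically simulable is the open Aaronson–Ambainis conjecture (tree `AAConjecture`, `AaronsonAmbainis2014_thm7`), not part of this barrier [cite: AaronsonAmbainis2014, Conjecture 6 and Thm 7]; the typed relational fact `yamakawaZhandry2022_totalSearch` is a query-model CONSEQUENCE of the printed Lemmas 6.11–6.12 (Boolean XOR queries to the bits of the oracle table, final-measurement output convention, asymptotic constants instantiated at a large security parameter), not a verbatim transcription; measures are the tree's `detQueryComplexity`, `randQueryComplexity (1/3)`, `quantumQueryComplexity (1/3)` (Beals et al. query model) and, for relations, `randRelQueryComplexity` / `quantumRelQueryComplexity` of this file.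
status: established (theorems in print; Thm 5.4 typed as a named fact with its no-go readings proved here and discharged in `TotalFunctionSpeedupLimitProofs.lean` — `TotalFunctionSpeedupLimit_holds`, constant 4096; ABKRT Thm 1 is the tree fact quantum-advantage.S12); scope NARROWED to decision problems by the 2026-08-16 barrier audit (relational evasion typed as `yamakawaZhandry2022_totalSearch`, a named fact) [cite: BealsEtAl2001, Thm 5.4] [cite: AaronsonBenDavidKothariRaoTal2021, Thm 1] [cite: YamakawaZhandry2022FOCS, Lemma 6.11 and Lemma 6.12] -/
def TotalFunctionSpeedupLimit : Prop :=
  bealsEtAl2001_thm54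

/-- The catalogue decl is Beals et al.'s Theorem 5.4 (definitional). [cite: BealsEtAl2001, Thm 5.4] -/
theorem totalFunctionSpeedupLimit_iff : TotalFunctionSpeedupLimit ↔ bealsEtAl2001_thm54 :=
  Iff.rfl

/-! ### The no-go theorems (proved) -/

/-- **No black-box speedup beyond the sixth power on total functions** (Beals et al. Thm 5.4).
[cite: BealsEtAl2001, Thm 5.4 and §1] -/
theorem TotalFunctionSpeedupLimit.not_totalSpeedupBeyond_six (h : TotalFunctionSpeedupLimit) :
    ¬ TotalSpeedupBeyond 6 :=
  not_totalSpeedupBeyond_of_bound h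

/-- **No black-box speedup beyond the fourth power on total functions**, granted the tree fact
quantum-advantage.S12 (ABKRT Thm 1, `detQueryComplexity_le_pow_four`).
[cite: AaronsonBenDavidKothariRaoTal2021, Thm 1] -/
theorem not_totalSpeedupBeyond_four (h4 : detQueryComplexity_le_pow_four) :
    ¬ TotalSpeedupBeyond 4 := by
  obtain ⟨C, hC⟩ := h4
  exact not_totalSpeedupBeyond_of_bound hC

/-- The same from the tree's weaker `∃ C` sixth-power fact alone. [cite: BealsEtAl2001, Thm 5.4] -/
theorem not_totalSpeedupBeyond_six_of_fact (h6 : detQueryComplexity_le_pow_six) :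
    ¬ TotalSpeedupBeyond 6 := by
  obtain ⟨C, hC⟩ := h6
  exact not_totalSpeedupBeyond_of_bound hC

/-- **Randomized form**: `R(f) ≤ D(f) ≤ 4096 Q₂(f)⁶` for every total `f` (through the tree
theorem `randQueryComplexity_le_det`), so bounded-error randomized and quantum query complexity
of total functions are polynomially related too. [cite: BealsEtAl2001, Thm 5.4 with §3 (Q₂ ≤ Q₀ ≤ Q_E ≤ D)] -/
theorem randQueryComplexity_le_of_thm54 (h : TotalFunctionSpeedupLimit) (N : ℕ)
    (f : (Fin N → Bool) → Bool) :
    (randQueryComplexity (1 / 3) f : ℝ) ≤ 4096 * (quantumQueryComplexity (1 / 3) f : ℝ) ^ 6 :=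
  le_trans (by exact_mod_cast randQueryComplexity_le_det (by norm_num) f) (h N f)

/-- Pointwise reading: a total function whose quantum query complexity is at most `q` has
deterministic query complexity at most `4096 q⁶` — e.g. `Q₂(f) ≤ polylog N` forces
`D(f) ≤ polylog N`, so "Parity or Majority"-type unstructured problems admit no superpolynomial
speedup. [cite: BealsEtAl2001, Thm 5.4] [cite: AaronsonAmbainis2014, §1 (p. 3)] -/
theorem detQueryComplexity_le_of_quantum_le (h : TotalFunctionSpeedupLimit) {N : ℕ}
    (f : (Fin N → Bool) → Bool) {q : ℝ} (hq : (quantumQueryComplexity (1 / 3) f : ℝ) ≤ q) :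
    (detQueryComplexity f : ℝ) ≤ 4096 * q ^ 6 := by
  refine le_trans (h N f) ?_
  have h0 : (0 : ℝ) ≤ (quantumQueryComplexity (1 / 3) f : ℝ) := Nat.cast_nonneg _
  have : (quantumQueryComplexity (1 / 3) f : ℝ) ^ 6 ≤ q ^ 6 := pow_le_pow_left₀ h0 hq 6
  linarith

/-! ### Where the barrier stops: total search problems (relations)

The polynomial relation `D(f) ≤ 4096 Q₂(f)⁶` is a statement about Boolean-valued total
FUNCTIONS. For SEARCH problems — relations `R : {0,1}ᴺ → Set O`, "on input `x` output any
admissible `o ∈ R x`" — the absence of a promise no longer forces a polynomial relation between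
classical and quantum query complexity: Yamakawa–Zhandry's proof of quantumness in the
random-oracle model, in its worst-case-complete form (arXiv:2204.02063, §6, "Achieving worst-case
correctness"), is a search problem over ARBITRARY oracle tables `H : [t] × Σ → {0,1}ⁿ`
(`|Σ| = 2^{λ^{Θ(1)}}`, `n, t = poly(λ)`; Lemma 4.2) whose admissible answers `π̃ = (K, (π⁽ʲ⁾)ⱼ)`
are those accepted by the deterministic verifier `Ṽerify^H(1^λ, π̃)` making `poly(λ)` classical
queries (Def. 6.1); the `poly(λ)`-query quantum prover succeeds with probability `1 - negl(λ)` for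
EVERY `H` (Lemma 6.11 — so the relation is total), while every classical algorithm making
`2^{λ^c}` queries succeeds with probability at most `|𝒦| · 2^{-Ω(tλ)} = 2^{-Ω(λ)}` over a random
`H` (Lemma 6.12), hence on some `H`. The definitions below type the relational query measures over
the tree's models so that this evasion is a named statement. -/

section Relations

variable {N : ℕ} {O : Type*}

/-- The transcript of oracle answers met by the decision tree `T` on input `x` along its
root-to-leaf path, in order. A deterministic query algorithm with outputs in an arbitrary type
`O` is a querying strategy `T` (its Boolean leaf labels are ignored) together with an output rule
`List Bool → O` applied to this transcript (Buhrman–de Wolf 2002, §2.1, decision trees; outputs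
generalised from bits to answers of a search problem). [folklore] -/
def answerPath (x : Fin N → Bool) : DecisionTree N → List Bool
  | .leaf _ => []
  | .query i t₀ t₁ => if x i then true :: answerPath x t₁ else false :: answerPath x t₀

/-- A leaf reads nothing. [folklore] -/
@[simp] theorem answerPath_leaf (x : Fin N → Bool) (b : Bool) :
    answerPath x (DecisionTree.leaf b) = [] :=
  rfl

/-- A query node records the answer and continues in the branch taken. [folklore] -/
@[simp] theorem answerPath_query (x : Fin N → Bool) (i : Fin N) (t₀ t₁ : DecisionTree N) :
    answerPath x (DecisionTree.query i t₀ t₁) =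
      if x i then true :: answerPath x t₁ else false :: answerPath x t₀ :=
  rfl

/-- The transcript is no longer than the depth of the tree (the number of queries on the worst
path). [folklore] -/
theorem length_answerPath_le_depth (x : Fin N → Bool) (T : DecisionTree N) :
    (answerPath x T).length ≤ T.depth := by
  induction T with
  | leaf b => simp
  | query i t₀ t₁ ih₀ ih₁ =>
    simp only [answerPath_query, DecisionTree.depth_query]
    split <;> simp only [List.length_cons] <;> omega

/-- The `ε`-error RANDOMIZED query complexity of the search problem (relation)
`R : {0,1}ᴺ → Set O` — on input `x`, output any admissible `o ∈ R x`: the least `d` such that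
some probability distribution over deterministic query algorithms `(T, out)` with `T` of depth
`≤ d` outputs an admissible answer with probability at least `1 - ε` on EVERY input `x`
(Buhrman–de Wolf 2002, §2.2 for Boolean functions — the tree's `randQueryComplexity`; for search
problems the classical adversaries of Yamakawa–Zhandry 2022, Def. 6.1, are exactly arbitrary
`Q`-query randomized algorithms with string output). Junk value `sInf ∅ = 0` when no distribution
qualifies (`ε < 0`, or `R x = ∅` for some `x`). [folklore] -/
noncomputable def randRelQueryComplexity (ε : ℝ) (R : (Fin N → Bool) → Set O) : ℕ :=
  sInf {d | ∃ μ : PMF (DecisionTree N × (List Bool → O)),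
    (∀ p ∈ μ.support, p.1.depth ≤ d) ∧
      ∀ x, 1 - ε ≤ (μ.toOuterMeasure {p | p.2 (answerPath x p.1) ∈ R x}).toReal}

open Classical in
/-- The success probability of the quantum query algorithm `A` (tree model `QQueryAlg`), with
its answer read off the final computational-basis measurement by the fixed map `out` (the
Beals et al. convention "measure, then output a fixed function of the outcome", here with range
`O`), on the search problem `R` at input `x`: the Born weight of the basis states whose answer is
admissible. [cite: BealsEtAl2001, §2] -/
noncomputable def qRelSuccessProb (A : QQueryAlg N) (out : Fin N × Bool × A.W → O)
    (R : (Fin N → Bool) → Set O) (x : Fin N → Bool) : ℝ :=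
  ∑ s with out s ∈ R x, ‖A.finalState x s‖ ^ 2

/-- Success probabilities are nonnegative. [folklore] -/
theorem qRelSuccessProb_nonneg (A : QQueryAlg N) (out : Fin N × Bool × A.W → O)
    (R : (Fin N → Bool) → Set O) (x : Fin N → Bool) : 0 ≤ qRelSuccessProb A out R x :=
  Finset.sum_nonneg fun _ _ => by positivity

/-- The `ε`-error QUANTUM query complexity of the search problem `R : {0,1}ᴺ → Set O`: the least
number of queries `T` of a quantum query algorithm (`QQueryAlg N`, output read off the final
measurement by a fixed map `out`) that answers admissibly with probability at least `1 - ε` on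
every input (Beals et al. 2001, §2, output convention; Yamakawa–Zhandry 2022, Def. 6.1: the prover
is a `poly(λ)`-query quantum algorithm that outputs a classical proof). Junk value `sInf ∅ = 0`
as for the tree's `quantumQueryComplexityOn` (`N = 0`, `ε < 0`). [folklore] -/
noncomputable def quantumRelQueryComplexity (ε : ℝ) (R : (Fin N → Bool) → Set O) : ℕ :=
  sInf {T | ∃ (A : QQueryAlg N) (out : Fin N × Bool × A.W → O),
    A.queries = T ∧ ∀ x, 1 - ε ≤ qRelSuccessProb A out R x}

/-- The search problem CHECKED by a family of deterministic verifiers: the answer `o` is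
admissible on input `x` iff the decision tree `V o` accepts `x` (Yamakawa–Zhandry 2022, Def. 6.1:
`Verify^H(1^λ, π)` is a deterministic algorithm making `poly(λ)` classical queries to the oracle,
one decision tree per candidate proof `π`). [cite: YamakawaZhandry2022FOCS, Def. 6.1] -/
def relOfVerifier (V : O → DecisionTree N) : (Fin N → Bool) → Set O :=
  fun x => {o | (V o).eval x = true}

/-- Membership in a verifier-defined search problem is acceptance by the verifier. [folklore] -/
@[simp] theorem mem_relOfVerifier_iff (V : O → DecisionTree N) (x : Fin N → Bool) (o : O) :
    o ∈ relOfVerifier V x ↔ (V o).eval x = true :=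
  Iff.rfl

end Relations

/-- **Technique class: black-box quantum speedups beyond the `d`-th power on TOTAL SEARCH
problems.** `TotalSearchSpeedupBeyond d`: for every constant `C` there is a search problem on
`N`-bit inputs with finitely many candidate answers, defined by verifiers `V o` of depth `≤ v`,
which is TOTAL — every input has an admissible answer, no promise — and whose bounded-error
randomized query complexity exceeds `C · (Q + v)^d`, where `Q` is its bounded-error quantum query
complexity. The verification cost `v` is charged to the quantum side, so that a promise cannot
be smuggled in through an expensive verifier (a partial function `f` on a promise `P` is the total
relation "`f x` if `x ∈ P`, anything otherwise", whose verifier has to decide `P`). The relational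
analogue of `TotalSpeedupBeyond d`; by `yamakawaZhandry2022_totalSearch` it holds for EVERY `d`,
whereas `TotalSpeedupBeyond 6` fails (`not_totalSpeedupBeyond_six`).
[cite: YamakawaZhandry2022FOCS, §1.3 ("Extension to worst-case completeness") and Lemma 6.11–6.12] [cite: Aaronson2022Structure, §7] -/
def TotalSearchSpeedupBeyond (d : ℕ) : Prop :=
  ∀ C : ℝ, ∃ (N : ℕ) (O : Type) (_ : Fintype O) (V : O → DecisionTree N) (v : ℕ),
    (∀ o, (V o).depth ≤ v) ∧ (∀ x, ∃ o, (V o).eval x = true) ∧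
      C * ((quantumRelQueryComplexity (1 / 3) (relOfVerifier V) : ℝ) + v) ^ d <
        (randRelQueryComplexity (1 / 3) (relOfVerifier V) : ℝ)

/-- **Yamakawa–Zhandry 2022, worst-case-complete proof of quantumness, read in the query model:
total search problems admit black-box quantum speedups beyond every power.** For the family of
folded Reed–Solomon codes of Lemma 4.2 and oracles `H : [t] × Σ → {0,1}ⁿ` presented as their
`N = t · |Σ| · n`-bit tables, the search problem "output `π̃ = (K, (π⁽ʲ⁾)ⱼ)` accepted by
`Ṽerify^H(1^λ, ·)`" (a deterministic verifier making `poly(λ)` classical queries, Def. 6.1 and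
§6 "Achieving worst-case correctness") is total and is solved with probability `1 - negl(λ)` on
EVERY `H` by the `poly(λ)`-query quantum prover `P̃rove` (Lemma 6.11, worst-case correctness),
while any classical algorithm making at most `2^{λ^c}` queries is accepted with probability at
most `|𝒦| · 2^{-Ω(tλ)} = 2^{-Ω(λ)}` over a uniformly random `H` (Lemma 6.12), hence fails on some
`H`: with `Q, v = poly(λ)` and randomized complexity `> 2^{λ^c}`, every polynomial
`C · (Q + v)^d` is eventually exceeded, i.e. `TotalSearchSpeedupBeyond d` for every `d`. (One
`n`-bit oracle answer is `n` Boolean queries for the quantum prover and at least one Boolean query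
for a classical adversary, so the bounds transfer to the Boolean query models of this file;
intermediate measurements of the prover are deferred to the final measurement.)
[cite: YamakawaZhandry2022FOCS, Lemma 6.11 and Lemma 6.12 (with Def. 6.1, Lemma 4.2, Lemma 6.10; arXiv:2204.02063 numbering)] -/
def yamakawaZhandry2022_totalSearch : Prop :=
  ∀ d : ℕ, TotalSearchSpeedupBeyond d

/-- **No polynomial relation between randomized and quantum query complexity for total search
problems** (even charging the verification cost to the quantum side) — the relational reading of
Yamakawa–Zhandry, to be contrasted with `not_totalSpeedupBeyond_six` /
`randQueryComplexity_le_of_thm54` for total functions.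
[cite: YamakawaZhandry2022FOCS, Lemma 6.11 and Lemma 6.12] [cite: Aaronson2022Structure, §7] -/
theorem yamakawaZhandry2022_totalSearch.not_polynomially_related
    (h : yamakawaZhandry2022_totalSearch) :
    ¬ ∃ (C : ℝ) (d : ℕ), ∀ (N : ℕ) (O : Type) [Fintype O] (V : O → DecisionTree N) (v : ℕ),
      (∀ o, (V o).depth ≤ v) → (∀ x, ∃ o, (V o).eval x = true) →
        (randRelQueryComplexity (1 / 3) (relOfVerifier V) : ℝ) ≤
          C * ((quantumRelQueryComplexity (1 / 3) (relOfVerifier V) : ℝ) + v) ^ d := by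
  rintro ⟨C, d, hCd⟩
  obtain ⟨N, O, hO, V, v, hv, htot, hlt⟩ := h d C
  exact absurd (@hCd N O hO V v hv htot) (not_le.mpr hlt)

/-- **The function/search dichotomy on unstructured inputs**: granted Beals et al.'s Theorem 5.4
(the barrier) and the Yamakawa–Zhandry fact, total FUNCTIONS admit no black-box quantum speedup
beyond the sixth power while total SEARCH problems admit speedups beyond every power — the
precise sense in which "structure" (a promise) is needed only for DECISION speedups.
[cite: BealsEtAl2001, Thm 5.4] [cite: YamakawaZhandry2022FOCS, Lemma 6.11 and Lemma 6.12] [cite: Aaronson2022Structure, §7] -/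
theorem TotalFunctionSpeedupLimit.function_search_dichotomy (h : TotalFunctionSpeedupLimit)
    (hYZ : yamakawaZhandry2022_totalSearch) :
    ¬ TotalSpeedupBeyond 6 ∧ ∀ d : ℕ, TotalSearchSpeedupBeyond d :=
  ⟨h.not_totalSpeedupBeyond_six, hYZ⟩

end Literature.Barriers.QuantumAdvantage

end
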